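import Summits.SmoothPoincare4.SmoothPoincare4.Theorems.SblfDescentRungOneHelperBottModelVec
import HarnessLib

/-!
# The polar tube from a global tube parametrisation (model layer of the Morse–Bott recognition)

Helper `helper_bott_model` of stub `helper_sliceGluing_bottRecognition` (fibred Morse–Bott
recognition of the polar tube), line `Sketch`, crux `SblfDescent.RungOne`; part 2 of 2 (part 1,
the model vector `(c y, s u)` and the points `ptV u y` of the polar tube, is
`SblfDescentRungOneHelperBottModelVec.lean`).

(Crux item stmt-SmoothPoincare4-18531; skeleton `Cruxes/RungOne/Lines/Sketch.lean`.)

Let `X` be a smooth `4`-manifold, `F : X → ℝ` smooth with regular level `a < b`, and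
`β : X → ℝ²`.  Suppose the superlevel set `V = {a ≤ F}` is globally parametrised by a tube:
a smooth map `Ν : 𝕊¹ × ℝ³ → X` and a map `Νinv : X → 𝕊¹ × ℝ³` with, for `‖y‖ ≤ √(b - a)`,
`F (Ν (u, y)) = b - ‖y‖²`, `β (Ν (u, y)) = u`, `Νinv (Ν (u, y)) = (u, y)`, and such that every
point of `V` is some `Ν (u, y)` with `‖y‖ ≤ √(b - a)` and `Νinv` is smooth at the points of `V`.
Then `V` (the compact `4`-manifold with boundary `Literature.Topology.FourManifolds.RegularSuperlevel`)
is diffeomorphic to the polar tube `V₀ = {x₃² + x₄² ≥ 1/2}` of the level `4`-sphere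
(`Literature.Topology.FourManifolds.SphereFourSplitting.PolarTube`), by the explicit map
`Ν (u, y) ↦ (y / √(2(b - a)), √(1 - ‖y‖² / (2 (b - a))) · u)`, which sends the level `F = a`
to the boundary `{x₃² + x₄² = 1/2}` and whose polar coordinates `(x₃, x₄)` are a positive
multiple of `β`.  This is the bookkeeping step "`S¹ × D³ ≅ V₀`" of the recognition of a
Morse–Bott tube about a maximum circle (Milnor 1963, Thm. 3.1 for the regular-domain
structures; Lee 2013, Cor. 5.30 for smoothness into regular domains).

## References

* J. Milnor, *Morse theory*, Ann. of Math. Studies 51 (1963), Thm. 3.1. [Milnor1963]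
* J. M. Lee, *Introduction to Smooth Manifolds*, 2nd ed. (2013), Cor. 5.30. [LeeSmoothManifolds2013]
-/

set_option linter.dupNamespace false

noncomputable section

open scoped Manifold ContDiff Topology
open Set Function Metric Module Literature.Topology.FourManifolds
  Literature.Topology.FourManifolds.SphereFourSplitting

namespace Summit.SmoothPoincare4.SmoothPoincare4.Cruxes.RungOne.Sketch

namespace BottModel

variable {a b : ℝ}

/-! ### The diffeomorphism from a global tube parametrisation -/

section Construction

variable {X : Type} [TopologicalSpace X] [ChartedSpace (EuclideanSpace ℝ (Fin 4)) X]
  [IsManifold (𝓡 4) ∞ X] {F : X → ℝ}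

omit [IsManifold (𝓡 4) ∞ X] in
/-- Points of `V = {a ≤ F}` have `a ≤ F`. [folklore] -/
theorem le_apply_incl (ha : IsRegularLevel (𝓡 4) F a) (k : RegularSuperlevel ha) :
    a ≤ F (RegularSublevel.incl ha.const_sub k) := by
  have h : a - F (RegularSublevel.incl ha.const_sub k) ≤ 0 := RegularSublevel.apply_incl_le ha.const_sub k
  linarith

/-- **The backward map `V₀ → V`** on points of `X`: `q ↦ Ν (uV q, √(2 (b - a)) • head3 (XV q))`.
[folklore] -/
def ofVpt (a b : ℝ) (Ν : (Metric.sphere (0 : EuclideanSpace ℝ (Fin 2)) 1) × EuclideanSpace ℝ (Fin 3) → X)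
    (q : PolarTube) : X :=
  Ν (uV q, √(2 * (b - a)) • head3 (XV q))

omit [IsManifold (𝓡 4) ∞ X] in
/-- The backward map on points is smooth if `Ν` is. [folklore] -/
theorem contMDiff_ofVpt (a b : ℝ)
    {Ν : (Metric.sphere (0 : EuclideanSpace ℝ (Fin 2)) 1) × EuclideanSpace ℝ (Fin 3) → X}
    (hΝ : ContMDiff ((𝓡 1).prod 𝓘(ℝ, EuclideanSpace ℝ (Fin 3))) (𝓡 4) ∞ Ν) :
    ContMDiff (𝓡∂ 4) (𝓡 4) ∞ (ofVpt a b Ν) := by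
  have h0 : ContMDiff (𝓡∂ 4) 𝓘(ℝ, EuclideanSpace ℝ (Fin 3)) ∞ fun q : PolarTube => head3 (XV q) :=
    contDiff_head3.comp_contMDiff contMDiff_XV
  have h1 : ContMDiff (𝓡∂ 4) 𝓘(ℝ, EuclideanSpace ℝ (Fin 3)) ∞ fun q : PolarTube =>
      √(2 * (b - a)) • head3 (XV q) :=
    (contDiff_const_smul (√(2 * (b - a)))).comp_contMDiff h0
  exact hΝ.comp (contMDiff_uV.prodMk h1)

variable (ha : IsRegularLevel (𝓡 4) F a) (β : X → EuclideanSpace ℝ (Fin 2))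
  (Ν : (Metric.sphere (0 : EuclideanSpace ℝ (Fin 2)) 1) × EuclideanSpace ℝ (Fin 3) → X)
  (Νinv : X → (Metric.sphere (0 : EuclideanSpace ℝ (Fin 2)) 1) × EuclideanSpace ℝ (Fin 3))
  (hab : a < b)
  (hid : ∀ (u : Metric.sphere (0 : EuclideanSpace ℝ (Fin 2)) 1) (y : EuclideanSpace ℝ (Fin 3)),
    ‖y‖ ≤ √(b - a) → F (Ν (u, y)) = b - ‖y‖ ^ 2 ∧ β (Ν (u, y)) = (u : EuclideanSpace ℝ (Fin 2)) ∧
      Νinv (Ν (u, y)) = (u, y))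
  (hV : ∀ x, a ≤ F x →
    ContMDiffAt (𝓡 4) ((𝓡 1).prod 𝓘(ℝ, EuclideanSpace ℝ (Fin 3))) ∞ Νinv x ∧
      ∃ (u : Metric.sphere (0 : EuclideanSpace ℝ (Fin 2)) 1) (y : EuclideanSpace ℝ (Fin 3)),
        ‖y‖ ≤ √(b - a) ∧ Ν (u, y) = x)

include hab hid hV

omit [IsManifold (𝓡 4) ∞ X] hab in
/-- **The tube coordinates of a point of `V`**: `‖y‖ ≤ √(b - a)` and `Ν (Νinv x) = x`. [folklore] -/
theorem norm_le_and_apply (k : RegularSuperlevel ha) :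
    ‖(Νinv (RegularSublevel.incl ha.const_sub k)).2‖ ≤ √(b - a) ∧
      Ν (Νinv (RegularSublevel.incl ha.const_sub k)) = RegularSublevel.incl ha.const_sub k := by
  obtain ⟨_, u, y, hy, hx⟩ := hV (RegularSublevel.incl ha.const_sub k) (le_apply_incl ha k)
  have h3 : Νinv (Ν (u, y)) = (u, y) := (hid u y hy).2.2
  rw [hx] at h3
  rw [h3]
  exact ⟨hy, hx⟩

/-- **The forward map `V → V₀`**, `Ν (u, y) ↦ ptV u y`. [folklore] -/
def toV (k : RegularSuperlevel ha) : PolarTube :=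
  ptV hab (Νinv (RegularSublevel.incl ha.const_sub k)).1 (Νinv (RegularSublevel.incl ha.const_sub k)).2
    (norm_le_and_apply ha β Ν Νinv hid hV k).1

omit [TopologicalSpace X] [ChartedSpace (EuclideanSpace ℝ (Fin 4)) X] [IsManifold (𝓡 4) ∞ X] hV in
/-- The backward map lands in `V`: `F (Ν (uV q, √(2 (b - a)) head3)) = b - 2 (b - a)(1 - u) ≥ a`.
[folklore] -/
theorem le_apply_ofVpt (q : PolarTube) : a ≤ F (ofVpt a b Ν q) := by
  rw [ofVpt, (hid _ _ (norm_backVec_le hab q)).1, norm_backVec_sq hab]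
  have h2 := half_le_tubeS_ιV q
  rw [tubeS] at h2
  change a ≤ b - 2 * (b - a) * (1 - tubeFn (ι (ιV q)))
  nlinarith

omit hV in
/-- **The backward map `V₀ → V`.** [folklore] -/
def ofV : PolarTube → RegularSuperlevel ha :=
  Set.codRestrict (ofVpt a b Ν) _ fun q =>
    show a - F (ofVpt a b Ν q) ≤ 0 by have := le_apply_ofVpt β Ν Νinv hab hid q; linarith

omit [IsManifold (𝓡 4) ∞ X] hV in
/-- `incl (ofV q) = ofVpt q` (definitional). [folklore] -/
@[simp] theorem incl_ofV (q : PolarTube) :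
    RegularSublevel.incl ha.const_sub (ofV ha β Ν Νinv hab hid q) = ofVpt a b Ν q :=
  rfl

omit [IsManifold (𝓡 4) ∞ X] in
/-- `V → V₀ → V` is the identity. [folklore] -/
theorem ofV_toV (k : RegularSuperlevel ha) : ofV ha β Ν Νinv hab hid (toV ha β Ν Νinv hab hid hV k) = k := by
  apply RegularSublevel.injective_incl ha.const_sub
  rw [incl_ofV, ofVpt]
  unfold toV
  rw [uV_ptV, smul_head3_XV_ptV]
  exact (norm_le_and_apply ha β Ν Νinv hid hV k).2

omit [IsManifold (𝓡 4) ∞ X] in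
/-- `V₀ → V → V₀` is the identity. [folklore] -/
theorem toV_ofV (q : PolarTube) : toV ha β Ν Νinv hab hid hV (ofV ha β Ν Νinv hab hid q) = q := by
  apply XV_injective
  unfold toV
  rw [XV_ptV]
  have h : Νinv (RegularSublevel.incl ha.const_sub (ofV ha β Ν Νinv hab hid q)) =
      (uV q, √(2 * (b - a)) • head3 (XV q)) := by
    rw [incl_ofV, ofVpt]
    exact (hid _ _ (norm_backVec_le hab q)).2.2
  rw [h]
  exact vec_uV_backVec hab q

omit hab hid in
/-- The tube coordinates `V → 𝕊¹ × ℝ³` are smooth (smoothness of `Νinv` at the points of `V`,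
composed with the smooth inclusion). [folklore] -/
theorem contMDiff_coords :
    ContMDiff (𝓡∂ 4) ((𝓡 1).prod 𝓘(ℝ, EuclideanSpace ℝ (Fin 3))) ∞
      fun k : RegularSuperlevel ha => Νinv (RegularSublevel.incl ha.const_sub k) := fun k =>
  (hV _ (le_apply_incl ha k)).1.comp k (RegularSublevel.contMDiff_incl ha.const_sub k)

/-- The model vector of a point of `V` depends smoothly on the point. [folklore] -/
theorem contMDiff_vec_coords :
    ContMDiff (𝓡∂ 4) 𝓘(ℝ, EuclideanSpace ℝ (Fin 5)) ∞ fun k : RegularSuperlevel ha =>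
      vec a b ((Νinv (RegularSublevel.incl ha.const_sub k)).1 : EuclideanSpace ℝ (Fin 2))
        (Νinv (RegularSublevel.incl ha.const_sub k)).2 := by
  haveI : Fact (finrank ℝ (EuclideanSpace ℝ (Fin 2)) = 1 + 1) := fact_finrank_euclideanSpace_succ 1
  have hp := contMDiff_coords ha Ν Νinv hV
  have hy : ∀ i : Fin 3, ContMDiff (𝓡∂ 4) 𝓘(ℝ, ℝ) ∞ fun k : RegularSuperlevel ha =>
      (Νinv (RegularSublevel.incl ha.const_sub k)).2 i := fun i =>
    (EuclideanSpace.proj i).contDiff.comp_contMDiff (contMDiff_snd.comp hp)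
  have hu : ∀ j : Fin 2, ContMDiff (𝓡∂ 4) 𝓘(ℝ, ℝ) ∞ fun k : RegularSuperlevel ha =>
      ((Νinv (RegularSublevel.incl ha.const_sub k)).1 : EuclideanSpace ℝ (Fin 2)) j := fun j =>
    (EuclideanSpace.proj j).contDiff.comp_contMDiff (contMDiff_coe_sphere.comp (contMDiff_fst.comp hp))
  have hn : ContMDiff (𝓡∂ 4) 𝓘(ℝ, ℝ) ∞ fun k : RegularSuperlevel ha =>
      1 - scale a b ^ 2 * ‖(Νinv (RegularSublevel.incl ha.const_sub k)).2‖ ^ 2 :=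
    contMDiff_const.sub (contMDiff_const.mul ((contDiff_norm_sq ℝ).comp_contMDiff (contMDiff_snd.comp hp)))
  have hr : ContMDiff (𝓡∂ 4) 𝓘(ℝ, ℝ) ∞ fun k : RegularSuperlevel ha =>
      rad a b (Νinv (RegularSublevel.incl ha.const_sub k)).2 := by
    intro k
    have hpos : 0 < 1 - scale a b ^ 2 * ‖(Νinv (RegularSublevel.incl ha.const_sub k)).2‖ ^ 2 := by
      have := half_le_one_sub hab (norm_le_and_apply ha β Ν Νinv hid hV k).1; linarith
    exact (Real.contDiffAt_sqrt hpos.ne').comp_contMDiffAt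
      (f := fun k : RegularSuperlevel ha => 1 - scale a b ^ 2 * ‖(Νinv (RegularSublevel.incl ha.const_sub k)).2‖ ^ 2)
      (x := k) (hn k)
  refine contMDiff_euclidean_of_coord fun i => ?_
  fin_cases i
  · exact contMDiff_const.mul (hy 0)
  · exact contMDiff_const.mul (hy 1)
  · exact contMDiff_const.mul (hy 2)
  · exact hr.mul (hu 0)
  · exact hr.mul (hu 1)

/-- **The forward map is smooth** (into `S` through `S ≅ 𝕊⁴`, then into the regular domain
`V₀`, Lee 2013, Cor. 5.30). [cite: LeeSmoothManifolds2013, Cor. 5.30] -/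
theorem contMDiff_toV : ContMDiff (𝓡∂ 4) (𝓡∂ 4) ∞ (toV ha β Ν Νinv hab hid hV) := by
  haveI : Fact (finrank ℝ (EuclideanSpace ℝ (Fin 5)) = 4 + 1) := fact_finrank_euclideanSpace_succ 4
  have hmem : ∀ k : RegularSuperlevel ha,
      vec a b ((Νinv (RegularSublevel.incl ha.const_sub k)).1 : EuclideanSpace ℝ (Fin 2))
        (Νinv (RegularSublevel.incl ha.const_sub k)).2 ∈ Metric.sphere (0 : EuclideanSpace ℝ (Fin 5)) 1 :=
    fun k => vec_mem_sphere hab (norm_coe_circle _) (norm_le_and_apply ha β Ν Νinv hid hV k).1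
  have hS : ContMDiff (𝓡∂ 4) (𝓡 4) ∞ fun k : RegularSuperlevel ha =>
      sphereLevelDiffeomorph.symm (Set.codRestrict _ _ hmem k) :=
    sphereLevelDiffeomorph.symm.contMDiff.comp ((contMDiff_vec_coords ha β Ν Νinv hab hid hV).codRestrict_sphere hmem)
  have hle : ∀ k : RegularSuperlevel ha,
      (fun q : LevelSphere => (1 : ℝ) / 2 - tubeS q) (sphereLevelDiffeomorph.symm (Set.codRestrict _ _ hmem k)) ≤ 0 :=
    fun k => RegularSublevel.apply_incl_le hPolar (toV ha β Ν Νinv hab hid hV k)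
  exact (RegularSublevel.halfSliceAtlas hPolar).contMDiff_codRestrict hle hS

omit hV in
/-- **The backward map is smooth** (Lee 2013, Cor. 5.30). [cite: LeeSmoothManifolds2013, Cor. 5.30] -/
theorem contMDiff_ofV (hΝ : ContMDiff ((𝓡 1).prod 𝓘(ℝ, EuclideanSpace ℝ (Fin 3))) (𝓡 4) ∞ Ν) :
    ContMDiff (𝓡∂ 4) (𝓡∂ 4) ∞ (ofV ha β Ν Νinv hab hid) :=
  (RegularSublevel.halfSliceAtlas ha.const_sub).contMDiff_codRestrict _ (contMDiff_ofVpt a b hΝ)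

/-- **`V ≅ V₀`.** [cite: Milnor1963, Thm. 3.1] [cite: LeeSmoothManifolds2013, Cor. 5.30] -/
def diffeo (hΝ : ContMDiff ((𝓡 1).prod 𝓘(ℝ, EuclideanSpace ℝ (Fin 3))) (𝓡 4) ∞ Ν) :
    RegularSuperlevel ha ≃ₘ⟮𝓡∂ 4, 𝓡∂ 4⟯ PolarTube where
  toFun := toV ha β Ν Νinv hab hid hV
  invFun := ofV ha β Ν Νinv hab hid
  left_inv := ofV_toV ha β Ν Νinv hab hid hV
  right_inv := toV_ofV ha β Ν Νinv hab hid hV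
  contMDiff_toFun := contMDiff_toV ha β Ν Νinv hab hid hV
  contMDiff_invFun := contMDiff_ofV ha β Ν Νinv hab hid hΝ

omit [IsManifold (𝓡 4) ∞ X] in
/-- **The level `F = a` goes to the boundary `u = 1/2`.** [folklore] -/
theorem tubeS_toV_of_eq (k : RegularSuperlevel ha) (hk : F (RegularSublevel.incl ha.const_sub k) = a) :
    tubeS (ιV (toV ha β Ν Νinv hab hid hV k)) = 1 / 2 := by
  unfold toV
  rw [tubeS_ιV_ptV]
  obtain ⟨hy, hx⟩ := norm_le_and_apply ha β Ν Νinv hid hV k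
  have hF := (hid (Νinv (RegularSublevel.incl ha.const_sub k)).1
    (Νinv (RegularSublevel.incl ha.const_sub k)).2 hy).1
  rw [Prod.mk.eta, hx, hk] at hF
  have hn : ‖(Νinv (RegularSublevel.incl ha.const_sub k)).2‖ ^ 2 = b - a := by linarith
  have h2 := scale_sq_mul hab
  rw [hn]
  linarith

omit [IsManifold (𝓡 4) ∞ X] in
/-- **The polar coordinates are a positive multiple of `β`.** [folklore] -/
theorem exists_polar_eq (k : RegularSuperlevel ha) : ∃ r : ℝ, 0 < r ∧
    ι (ιV (toV ha β Ν Νinv hab hid hV k)) 3 = r * β (RegularSublevel.incl ha.const_sub k) 0 ∧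
    ι (ιV (toV ha β Ν Νinv hab hid hV k)) 4 = r * β (RegularSublevel.incl ha.const_sub k) 1 := by
  obtain ⟨hy, hx⟩ := norm_le_and_apply ha β Ν Νinv hid hV k
  have hβ := (hid (Νinv (RegularSublevel.incl ha.const_sub k)).1
    (Νinv (RegularSublevel.incl ha.const_sub k)).2 hy).2.1
  rw [Prod.mk.eta, hx] at hβ
  refine ⟨rad a b (Νinv (RegularSublevel.incl ha.const_sub k)).2, rad_pos hab hy, ?_, ?_⟩
  · change XV (toV ha β Ν Νinv hab hid hV k) 3 = _
    unfold toV
    rw [XV_ptV, vec_apply_three, hβ]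
  · change XV (toV ha β Ν Νinv hab hid hV k) 4 = _
    unfold toV
    rw [XV_ptV, vec_apply_four, hβ]

end Construction

end BottModel

/-- **The polar tube from a global tube parametrisation** (model layer of the fibred Morse–Bott
recognition `helper_sliceGluing_bottRecognition`).  `X` a smooth `4`-manifold, `F : X → ℝ`
smooth with regular level `a`, `a < b`, `β : X → ℝ²`; `Ν : 𝕊¹ × ℝ³ → X` smooth and
`Νinv : X → 𝕊¹ × ℝ³` with `F (Ν (u, y)) = b - ‖y‖²`, `β (Ν (u, y)) = u`, `Νinv (Ν (u, y)) = (u, y)`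
for `‖y‖ ≤ √(b - a)`, every point of `{a ≤ F}` of the form `Ν (u, y)`, `‖y‖ ≤ √(b - a)`, and
`Νinv` smooth at the points of `{a ≤ F}`.  Then the regular superlevel set `{a ≤ F}` is
diffeomorphic to the polar tube `V₀ = {x₃² + x₄² ≥ 1/2} ⊆ S⁴` by a diffeomorphism taking the
level `F = a` to `∂V₀ = {x₃² + x₄² = 1/2}` and with polar coordinates `(x₃, x₄)` a positive
multiple of `β` (namely `Ν (u, y) ↦ (y / √(2 (b - a)), √(1 - ‖y‖²/(2 (b - a))) u)`).
[cite: Milnor1963, Thm. 3.1] [cite: LeeSmoothManifolds2013, Cor. 5.30] -/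
theorem helper_bott_model : ∀ (X : Type) [TopologicalSpace X] [ChartedSpace (EuclideanSpace ℝ (Fin 4)) X] [IsManifold (𝓡 4) ∞ X] (F : X → ℝ) (a b : ℝ) (ha : IsRegularLevel (𝓡 4) F a) (β : X → EuclideanSpace ℝ (Fin 2)) (Ν : (Metric.sphere (0 : EuclideanSpace ℝ (Fin 2)) 1) × EuclideanSpace ℝ (Fin 3) → X) (Νinv : X → (Metric.sphere (0 : EuclideanSpace ℝ (Fin 2)) 1) × EuclideanSpace ℝ (Fin 3)), a < b → ContMDiff ((𝓡 1).prod 𝓘(ℝ, EuclideanSpace ℝ (Fin 3))) (𝓡 4) ∞ Ν → (∀ (u : Metric.sphere (0 : EuclideanSpace ℝ (Fin 2)) 1) (y : EuclideanSpace ℝ (Fin 3)), ‖y‖ ≤ √(b - a) → F (Ν (u, y)) = b - ‖y‖ ^ 2 ∧ β (Ν (u, y)) = (u : EuclideanSpace ℝ (Fin 2)) ∧ Νinv (Ν (u, y)) = (u, y)) → (∀ x, a ≤ F x → ContMDiffAt (𝓡 4) ((𝓡 1).prod 𝓘(ℝ, EuclideanSpace ℝ (Fin 3))) ∞ Νinv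 x ∧ ∃ (u : Metric.sphere (0 : EuclideanSpace ℝ (Fin 2)) 1) (y : EuclideanSpace ℝ (Fin 3)), ‖y‖ ≤ √(b - a) ∧ Ν (u, y) = x) → ∃ Φ : RegularSuperlevel ha ≃ₘ⟮𝓡∂ 4, 𝓡∂ 4⟯ SphereFourSplitting.PolarTube, (∀ k : RegularSuperlevel ha, F (RegularSublevel.incl ha.const_sub k) = a → SphereFourSplitting.tubeS (SphereFourSplitting.ιV (Φ k)) = 1 / 2) ∧ ∀ k : RegularSuperlevel ha, ∃ r : ℝ, 0 < r ∧ SphereFourSplitting.ι (SphereFourSplitting.ιV (Φ k)) 3 = r * (β (RegularSublevel.incl ha.const_sub k)) 0 ∧ SphereFourSplitting.ι (SphereFourSplitting.ιV (Φ k)) 4 = r * (β (RegularSublevel.incl ha.const_sub k)) 1 := by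
  intro X _ _ _ F a b ha β Ν Νinv hab hΝ hid hV
  exact ⟨BottModel.diffeo ha β Ν Νinv hab hid hV hΝ, fun k hk => BottModel.tubeS_toV_of_eq ha β Ν Νinv hab hid hV k hk,
    fun k => BottModel.exists_polar_eq ha β Ν Νinv hab hid hV k⟩

end Summit.SmoothPoincare4.SmoothPoincare4.Cruxes.RungOne.Sketch

end
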